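import Literature.MathematicalPhysics.QuantumFieldTheory.Balaban1983to89.B9Eq334LaplaceAkCovariance

/-!
# `Balaban1983to89.B9Eq334GreenkCovariance` — T. Bałaban, *Propagators for lattice gauge theories in a background field*, Commun. Math. Phys. **99** (1985)
# 389–434 [Balaban1985BackgroundPropagators] (3.34) p. 396 with (3.126) p. 420, (3.153) p. 426; [Balaban1985Variational] (45) p. 285, (103) p. 293:
# **(3.34b) ONE STOREY UP — `G_k(U^u)R(u) = R(u)G_k(U)`, `(Q_kG_kQ_k*)⁻¹(U^u)R(u_0) = R(u_0)(Q_kG_kQ_k*)⁻¹(U)`, `H_{1,k}(U^u)R(u_0) = R(u)H_{1,k}(U)`,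
# `𝔊_k(U^u)R(u) = R(u)𝔊_k(U)`** for the chain's `k`-level Green's letters (`B11Eq103H1Complex.G1LatticeK ∕ KinvLatticeK ∕ H1LatticeK ∕ frakGLatticeK` at
# `Δ^{(n+1)}_a(U)` = `B9Eq326OperatorTower.laplaceAk`), and the MASS ROWS of the Green's letters carried along the orbit with the same constants

statement-level skeleton of published theorems with citation tags; proofs where landed; nothing here is a claim about the Yang–Mills mass gap

CITATION HEADER (lean-in-tree rule).  Audit cell `pub-balaban`, sub-cell `t4`, BINDER row NE9; filed by NE9 formalisation-swarm leaf prover 03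
(`b2b-balaban-t4-ne9-formalise-leaf-03`, gen 65), INTENT I-ne9leaf03-g65-7 — the one-step `B9Eq334LaplaceACovariance` §3 (`G1ofU_gaugeU`, `KinvLatticeK_gaugeU`,
`H1ofU_gaugeU`, `frakGofU_gaugeU`) VERBATIM one storey up over this lineage's INTENT-3 `B9Eq334LaplaceAkCovariance` (the row owner g86's W-5: «the mass rows of
`𝔊_k`, `H_{1,k}Q_kG_k` on the orbit … are yours by the same conjugation»).  Objects BY NAME; nothing re-declared, 0 `def`.

THE PRINT (verbatim, p. 396 (3.34)): *«G(U^u) = R(u)G(U)R(u⁻¹)»*; p. 426: *«(3.147), (3.153) permit us to reduce properties of 𝔓, 𝔊 to the corresponding properties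
of G′, (Q′G′²Q′*)⁻¹, G₁, (QG₁Q*)⁻¹»*.

WHAT IS PROVED (sorry-free; proof lane — 0 `def`; [folklore] inverses and compositions of intertwined maps are intertwined).  Setting of INTENT-3 (print's class
(52) for `Ũ`, `S`-valued `U` and gauge `u`, unitarity letters `hτ`, `hstar`, `hAd`), positivity of `Δ^{(n+1)}_a` displayed on BOTH sides (one follows from the
other by INTENT-3's `hposk_gaugeU_iff`), `Q_{n+1}` onto displayed on both sides where `(Q_kG_kQ_k*)⁻¹` enters:
* §1 **`G1k_gaugeU`**, **`Kinvk_gaugeU`**, **`H1k_gaugeU`**, **`frakGk_gaugeU`** — the four intertwining identities.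
* §2 **`norm_G1k_gaugeU_of_bound`**, **`norm_H1kQkG1k_gaugeU_of_bound`**, **`norm_frakGk_gaugeU_of_bound`** — a mass-row bound `‖Xy‖ ≤ C‖y‖` for the letter at
  `U` gives the same bound at `U^u` (`R(u)`, `R(u_0)` isometric).
HONEST SCOPE.  [folklore]; identities + isometry; the flat `D`-rows do NOT transfer (not gauge covariant) and are not claimed; nothing of [B9] asserted
hypothesis-free; «NE9 ⇐ the named binders»; NE9 NOT PRINTED ∕ NOT PROVED; NOT summit progress (cell pub-balaban: row NE9 WALLED ON A MODEL; spine PROVED 0/9; rung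
(B)+1 finite T⁴ — NOT infinite volume, NOT mass gap, NOT Clay; HONEST DEPENDENCY: continuum YM on T⁴ ⇐ BetaPertH ∧ nine spine estimates (0/9 proved); BetaPertH ⇐
(D1) ∧ (D4) ∧ CAP+tail; G-an2-4 gates asym, D1 and NE2/3/4).  NEW file; modifies nothing.  Net new unproved facts: 0.
-/

noncomputable section

open scoped InnerProductSpace ComplexConjugate BigOperators

namespace Literature.MathematicalPhysics.QuantumFieldTheory.Balaban1983to89.B9Eq334GreenkCovariance

open B4Sect5Torus (TSite)
open B9SectCLatticeCarrier (Bond bpos)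
open B7Prop1Explicit (U1 Wcx boxVec)
open B7Prop2Explicit (pdev C0 c2' AvgClosed)
open B11Eq103H1Complex (SiteL2K BondL2K covDivL2K G1LatticeK KinvLatticeK H1LatticeK frakGLatticeK laplaceALatticeK_G1LatticeK G1K_laplaceAK hK_lattice
  greenK_apply re_inner_KK_pos hadj_adjoint adjoint_injective_of_surjective)
open B9Eq310HessianOperator (adTransportW)
open B9Eq315QTorus (perSite perCfg cornerSite)
open B9Eq315QTorusOnto (liftSite)
open B9Eq315QTower (towerP UlevOf)
open B9Eq326OperatorTower (QkW RofUk laplaceAk)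
open B9Eq328GaugeAction (gaugeU AdA AdW gaugeW gaugeW_apply_inv inner_gaugeW norm_gaugeW covDerivL2K_gaugeU covDivL2K_gaugeU)
open B9Eq334LaplaceACovariance (adjointQ_gaugeU)
open B9Eq334LaplaceAkCovariance (QkW_gaugeU RofUk_gaugeU laplaceAk_gaugeU)

variable {d : ℕ} (L : ℕ) [NeZero L] (m : Fin d → ℕ) [∀ i, NeZero (m i)] (n : ℕ)
  {𝔸 : Type*} [NormedRing 𝔸] [NormOneClass 𝔸] [NormedAlgebra ℂ 𝔸] [CompleteSpace 𝔸] [StarRing 𝔸] [StarModule ℂ 𝔸] (hL : 1 ≤ L) (hL2 : 2 ≤ L)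
  {S : Subgroup 𝔸ˣ} (hS : AvgClosed d L S) (U : Bond d (towerP L m (n + 1)) → 𝔸ˣ) (hU : ∀ b, U b ∈ S) (g : TSite d (towerP L m (n + 1)) → 𝔸ˣ)
  (hg : ∀ x, g x ∈ S) {α₀ : ℝ} (hα : 0 < α₀) (hα3 : C0 d * α₀ ≤ 1 / 3) (hα2 : 2 * α₀ ≤ c2' d L)
  (h52 : pdev (perCfg (towerP L m (n + 1)) U) < α₀ * (((L : ℝ) ^ (n + 1))⁻¹) ^ 2)
  {W : Type*} [NormedAddCommGroup W] [InnerProductSpace ℂ W] [FiniteDimensional ℂ W] (φ : W ≃ₗ[ℂ] 𝔸) {c₀ c₁ : ℝ} [Fact (0 < c₀)] [Fact (0 < c₁)]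
  (τ : 𝔸 →ₗ[ℂ] ℂ) (η : ℝ) (αU : ℕ → ℝ) (hα1 : ∀ j, αU j ≤ 1 / 64)
  (hU1 : ∀ (j : ℕ) (x : B7Prop1Explicit.Site d) (κ : Fin d), perCfg (towerP L m (j + 1)) (UlevOf L m (n + 1) U j) x κ ∈ U1 𝔸)
  (hreg : ∀ (j : ℕ) (y : TSite d (towerP L m j)) (κ : Fin d) (r : Fin d → Fin L),
    ‖((Wcx L (perCfg (towerP L m (j + 1)) (UlevOf L m (n + 1) U j)) (cornerSite L y) κ (boxVec L r) : 𝔸ˣ) : 𝔸) - 1‖ ≤ αU j)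
  (hU1' : ∀ (j : ℕ) (x : B7Prop1Explicit.Site d) (κ : Fin d), perCfg (towerP L m (j + 1)) (UlevOf L m (n + 1) (gaugeU g U) j) x κ ∈ U1 𝔸)
  (hreg' : ∀ (j : ℕ) (y : TSite d (towerP L m j)) (κ : Fin d) (r : Fin d → Fin L),
    ‖((Wcx L (perCfg (towerP L m (j + 1)) (UlevOf L m (n + 1) (gaugeU g U) j)) (cornerSite L y) κ (boxVec L r) : 𝔸ˣ) : 𝔸) - 1‖ ≤ αU j)
  (hτ : ∀ (x : TSite d (towerP L m (n + 1))) (X : 𝔸), τ (AdA (g x) X) = τ X) (hstar : ∀ x, star (g x : 𝔸) = ((g x)⁻¹ : 𝔸ˣ))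
  (hAd : ∀ (x : TSite d (towerP L m (n + 1))) (v v' : W), ⟪AdW φ (g x) v, AdW φ (g x) v'⟫_ℂ = ⟪v, v'⟫_ℂ) {a : ℝ}
  (hpos : ∀ x : BondL2K ℂ d (towerP L m (n + 1)) c₀ W, x ≠ 0 →
    0 < RCLike.re ⟪x, laplaceAk L m n φ η U hL αU hα1 hU1 hreg τ (c₀ := c₀) (c₁ := c₁) a x⟫_ℂ)
  (hpos' : ∀ x : BondL2K ℂ d (towerP L m (n + 1)) c₀ W, x ≠ 0 →
    0 < RCLike.re ⟪x, laplaceAk L m n φ η (gaugeU g U) hL αU hα1 hU1' hreg' τ (c₀ := c₀) (c₁ := c₁) a x⟫_ℂ)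

/-! ## §1 The four intertwining identities -/

include hL2 hS hU hg hα hα3 hα2 h52 hτ hstar hAd in
/-- **(3.34b) ONE STOREY UP: `G_k(U^u)(R(u)f) = R(u)(G_k(U)f)`** for `G_k = (Δ^{(n+1)}_a)⁻¹` (`G1LatticeK`, positivity displayed on both sides).
[cite: Balaban1985BackgroundPropagators, (3.34) p.396] -/
theorem G1k_gaugeU (f : BondL2K ℂ d (towerP L m (n + 1)) c₀ W) :
    G1LatticeK hpos' (gaugeW φ (fun b : Bond d (towerP L m (n + 1)) => g (bpos b)) f) =
      gaugeW φ (fun b : Bond d (towerP L m (n + 1)) => g (bpos b)) (G1LatticeK hpos f) := by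
  have key : laplaceAk L m n φ η (gaugeU g U) hL αU hα1 hU1' hreg' τ (c₀ := c₀) (c₁ := c₁) a
        (gaugeW φ (fun b : Bond d (towerP L m (n + 1)) => g (bpos b)) (G1LatticeK hpos f)) =
      gaugeW φ (fun b : Bond d (towerP L m (n + 1)) => g (bpos b)) f := by
    rw [laplaceAk_gaugeU L m n hL hL2 hS U hU g hg hα hα3 hα2 h52 φ τ η αU hα1 hU1 hreg hU1' hreg' hτ hstar hAd]
    congr 1
    exact laplaceALatticeK_G1LatticeK hpos f
  rw [← key]
  exact G1K_laplaceAK hpos' _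

include hL2 hS hU hg hα hα3 hα2 h52 hτ hstar hAd in
/-- **`(Q_kG_kQ_k*)⁻¹(U^u) R(u_0) = R(u_0) (Q_kG_kQ_k*)⁻¹(U)`** for the constructed `KinvLatticeK` (`Q_{n+1}` onto displayed on both sides; `u_0(c₋) = u(N·c̃₋)` the
gauge at the unit block origins). [cite: Balaban1985BackgroundPropagators, (3.34) p.396; Balaban1985Variational, (45) p.285] -/
theorem Kinvk_gaugeU (hQs : Function.Surjective (QkW L m n φ U hL αU hα1 hU1 hreg (c₀ := c₀) (c₁ := c₁)))
    (hQs' : Function.Surjective (QkW L m n φ (gaugeU g U) hL αU hα1 hU1' hreg' (c₀ := c₀) (c₁ := c₁))) (h : BondL2K ℂ d m c₁ W) :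
    KinvLatticeK hpos' hQs' (gaugeW φ (fun c : Bond d m => g (perSite (towerP L m (n + 1)) (((L : ℤ) ^ (n + 1)) • liftSite (bpos c)))) h) =
      gaugeW φ (fun c : Bond d m => g (perSite (towerP L m (n + 1)) (((L : ℤ) ^ (n + 1)) • liftSite (bpos c)))) (KinvLatticeK hpos hQs h) := by
  set Q := QkW L m n φ U hL αU hα1 hU1 hreg (c₀ := c₀) (c₁ := c₁) with hQdef
  set Q' := QkW L m n φ (gaugeU g U) hL αU hα1 hU1' hreg' (c₀ := c₀) (c₁ := c₁) with hQ'def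
  set TF := gaugeW φ (fun c : Bond d m => g (perSite (towerP L m (n + 1)) (((L : ℤ) ^ (n + 1)) • liftSite (bpos c)))) (w := fun _ : Bond d m => c₁)
    with hTFdef
  have hTF : ∀ h h' : BondL2K ℂ d m c₁ W, ⟪TF h, TF h'⟫_ℂ = ⟪h, h'⟫_ℂ := inner_gaugeW φ (w := fun _ : Bond d m => c₁) _ fun c => hAd _
  have hQ : ∀ f, Q' (gaugeW φ (fun b : Bond d (towerP L m (n + 1)) => g (bpos b)) f) = TF (Q f) :=
    fun f => QkW_gaugeU L m n hL hL2 hS U hU g hg hα hα3 hα2 h52 φ αU hα1 hU1 hreg hU1' hreg' f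
  have hadjQ : ∀ h' : BondL2K ℂ d m c₁ W,
      LinearMap.adjoint Q' (TF h') = gaugeW φ (fun b : Bond d (towerP L m (n + 1)) => g (bpos b)) (LinearMap.adjoint Q h') :=
    fun h' => adjointQ_gaugeU L (towerP L m n) φ Q Q' TF hAd hTF hQ h'
  have hG1 : ∀ f, G1LatticeK hpos' (gaugeW φ (fun b : Bond d (towerP L m (n + 1)) => g (bpos b)) f) =
      gaugeW φ (fun b : Bond d (towerP L m (n + 1)) => g (bpos b)) (G1LatticeK hpos f) :=
    fun f => G1k_gaugeU L m n hL hL2 hS U hU g hg hα hα3 hα2 h52 φ τ η αU hα1 hU1 hreg hU1' hreg' hτ hstar hAd hpos hpos' f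
  have hK : Q' (G1LatticeK hpos' (LinearMap.adjoint Q' (TF (KinvLatticeK hpos hQs h)))) = TF h := by
    rw [hadjQ, hG1, hQ]
    congr 1
    exact hK_lattice hpos hQs h
  rw [← hK]
  exact greenK_apply (re_inner_KK_pos hpos' hadj_adjoint (adjoint_injective_of_surjective Q' hQs')) _

include hL2 hS hU hg hα hα3 hα2 h52 hτ hstar hAd in
/-- **`H_{1,k}(U^u) R(u_0) = R(u) H_{1,k}(U)`** for `H_{1,k} = G_kQ_k*(Q_kG_kQ_k*)⁻¹` (`H1LatticeK`). [cite: Balaban1985BackgroundPropagators, (3.34) p.396, (3.126) p.420; Balaban1985Variational, (103) p.293] -/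
theorem H1k_gaugeU (hQs : Function.Surjective (QkW L m n φ U hL αU hα1 hU1 hreg (c₀ := c₀) (c₁ := c₁)))
    (hQs' : Function.Surjective (QkW L m n φ (gaugeU g U) hL αU hα1 hU1' hreg' (c₀ := c₀) (c₁ := c₁))) (b : BondL2K ℂ d m c₁ W) :
    H1LatticeK hpos' hQs' (gaugeW φ (fun c : Bond d m => g (perSite (towerP L m (n + 1)) (((L : ℤ) ^ (n + 1)) • liftSite (bpos c)))) b) =
      gaugeW φ (fun b : Bond d (towerP L m (n + 1)) => g (bpos b)) (H1LatticeK hpos hQs b) := by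
  have hadjQ : ∀ h' : BondL2K ℂ d m c₁ W,
      LinearMap.adjoint (QkW L m n φ (gaugeU g U) hL αU hα1 hU1' hreg' (c₀ := c₀) (c₁ := c₁))
          (gaugeW φ (fun c : Bond d m => g (perSite (towerP L m (n + 1)) (((L : ℤ) ^ (n + 1)) • liftSite (bpos c)))) h') =
        gaugeW φ (fun b : Bond d (towerP L m (n + 1)) => g (bpos b)) (LinearMap.adjoint (QkW L m n φ U hL αU hα1 hU1 hreg (c₀ := c₀) (c₁ := c₁)) h') :=
    fun h' => adjointQ_gaugeU L (towerP L m n) φ _ _ _ hAd (inner_gaugeW φ (w := fun _ : Bond d m => c₁) _ fun c => hAd _)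
      (fun f => QkW_gaugeU L m n hL hL2 hS U hU g hg hα hα3 hα2 h52 φ αU hα1 hU1 hreg hU1' hreg' f) h'
  show G1LatticeK hpos' (LinearMap.adjoint (QkW L m n φ (gaugeU g U) hL αU hα1 hU1' hreg' (c₀ := c₀) (c₁ := c₁))
      (KinvLatticeK hpos' hQs' (gaugeW φ (fun c : Bond d m => g (perSite (towerP L m (n + 1)) (((L : ℤ) ^ (n + 1)) • liftSite (bpos c)))) b))) =
    gaugeW φ (fun b : Bond d (towerP L m (n + 1)) => g (bpos b))
      (G1LatticeK hpos (LinearMap.adjoint (QkW L m n φ U hL αU hα1 hU1 hreg (c₀ := c₀) (c₁ := c₁)) (KinvLatticeK hpos hQs b)))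
  rw [Kinvk_gaugeU L m n hL hL2 hS U hU g hg hα hα3 hα2 h52 φ τ η αU hα1 hU1 hreg hU1' hreg' hτ hstar hAd hpos hpos' hQs hQs', hadjQ,
    G1k_gaugeU L m n hL hL2 hS U hU g hg hα hα3 hα2 h52 φ τ η αU hα1 hU1 hreg hU1' hreg' hτ hstar hAd hpos hpos']

include hL2 hS hU hg hα hα3 hα2 h52 hτ hstar hAd in
/-- **`𝔊_k(U^u) R(u) = R(u) 𝔊_k(U)`** for `𝔊_k = G_k − G_kQ_k*(Q_kG_kQ_k*)⁻¹Q_kG_k − G_kDR_kD*G_k` (`frakGLatticeK`, [B9] (3.153)).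
[cite: Balaban1985BackgroundPropagators, (3.34) p.396, (3.153) p.426] -/
theorem frakGk_gaugeU (hQs : Function.Surjective (QkW L m n φ U hL αU hα1 hU1 hreg (c₀ := c₀) (c₁ := c₁)))
    (hQs' : Function.Surjective (QkW L m n φ (gaugeU g U) hL αU hα1 hU1' hreg' (c₀ := c₀) (c₁ := c₁))) (f : BondL2K ℂ d (towerP L m (n + 1)) c₀ W) :
    frakGLatticeK hpos' hQs' (gaugeW φ (fun b : Bond d (towerP L m (n + 1)) => g (bpos b)) f) =
      gaugeW φ (fun b : Bond d (towerP L m (n + 1)) => g (bpos b)) (frakGLatticeK hpos hQs f) := by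
  have hQ : ∀ f, QkW L m n φ (gaugeU g U) hL αU hα1 hU1' hreg' (c₀ := c₀) (c₁ := c₁) (gaugeW φ (fun b : Bond d (towerP L m (n + 1)) => g (bpos b)) f) =
      gaugeW φ (fun c : Bond d m => g (perSite (towerP L m (n + 1)) (((L : ℤ) ^ (n + 1)) • liftSite (bpos c)))) (QkW L m n φ U hL αU hα1 hU1 hreg (c₀ := c₀) (c₁ := c₁) f) :=
    fun f => QkW_gaugeU L m n hL hL2 hS U hU g hg hα hα3 hα2 h52 φ αU hα1 hU1 hreg hU1' hreg' f
  have hadjQ : ∀ h' : BondL2K ℂ d m c₁ W,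
      LinearMap.adjoint (QkW L m n φ (gaugeU g U) hL αU hα1 hU1' hreg' (c₀ := c₀) (c₁ := c₁))
          (gaugeW φ (fun c : Bond d m => g (perSite (towerP L m (n + 1)) (((L : ℤ) ^ (n + 1)) • liftSite (bpos c)))) h') =
        gaugeW φ (fun b : Bond d (towerP L m (n + 1)) => g (bpos b)) (LinearMap.adjoint (QkW L m n φ U hL αU hα1 hU1 hreg (c₀ := c₀) (c₁ := c₁)) h') :=
    fun h' => adjointQ_gaugeU L (towerP L m n) φ _ _ _ hAd (inner_gaugeW φ (w := fun _ : Bond d m => c₁) _ fun c => hAd _) hQ h'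
  have hG := G1k_gaugeU L m n hL hL2 hS U hU g hg hα hα3 hα2 h52 φ τ η αU hα1 hU1 hreg hU1' hreg' hτ hstar hAd hpos hpos'
  rw [frakGLatticeK, frakGLatticeK, B11Eq111FrakG.frakGLin_apply, B11Eq111FrakG.frakGLin_apply, hG, hQ,
    Kinvk_gaugeU L m n hL hL2 hS U hU g hg hα hα3 hα2 h52 φ τ η αU hα1 hU1 hreg hU1' hreg' hτ hstar hAd hpos hpos' hQs hQs', hadjQ, hG,
    covDivL2K_gaugeU, RofUk_gaugeU L m n hL2 hS U hU g hg hα hα3 hα2 h52 φ η hAd, covDerivL2K_gaugeU, hG, map_sub, map_sub]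

/-! ## §2 Mass-row bounds transfer along the orbit -/

omit [NormOneClass 𝔸] [CompleteSpace 𝔸] [NeZero L] [∀ i, NeZero (m i)] [StarRing 𝔸] [StarModule ℂ 𝔸] [Fact (0 < c₀)] in
/-- `R(u)` isometric ⇒ a bound `‖X(R(u)y)‖ … ` — the generic transfer: if `X′ ∘ T = T′ ∘ X` with `T, T′` norm-preserving and `T` onto, a bound `‖Xy‖ ≤ C‖y‖` for all `y`
gives `‖X′y′‖ ≤ C‖y′‖` for all `y′`. [folklore] -/
private theorem norm_le_of_intertwine {E E' F F' : Type*} [NormedAddCommGroup E] [NormedAddCommGroup E'] [NormedAddCommGroup F] [NormedAddCommGroup F']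
    (X : E → F) (X' : E' → F') (T : E → E') (T' : F → F') (hT : Function.Surjective T) (hTn : ∀ y, ‖T y‖ = ‖y‖) (hT'n : ∀ z, ‖T' z‖ = ‖z‖)
    (hX : ∀ y, X' (T y) = T' (X y)) {C : ℝ} (hC : ∀ y, ‖X y‖ ≤ C * ‖y‖) (y' : E') : ‖X' y'‖ ≤ C * ‖y'‖ := by
  obtain ⟨y, rfl⟩ := hT y'
  rw [hX, hT'n, hTn]
  exact hC y

include hL2 hS hU hg hα hα3 hα2 h52 hτ hstar hAd in
/-- **`‖G_k(U^u)y‖ ≤ C‖y‖` from `‖G_k(U)y‖ ≤ C‖y‖`** (same `C`). [cite: Balaban1985BackgroundPropagators, (3.34) p.396, Thm 3.4 p.400] -/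
theorem norm_G1k_gaugeU_of_bound {C : ℝ} (hC : ∀ y : BondL2K ℂ d (towerP L m (n + 1)) c₀ W, ‖G1LatticeK hpos y‖ ≤ C * ‖y‖)
    (y : BondL2K ℂ d (towerP L m (n + 1)) c₀ W) : ‖G1LatticeK hpos' y‖ ≤ C * ‖y‖ :=
  norm_le_of_intertwine _ _ (gaugeW φ (fun b : Bond d (towerP L m (n + 1)) => g (bpos b)) (w := fun _ : Bond d (towerP L m (n + 1)) => c₀))
    (gaugeW φ (fun b : Bond d (towerP L m (n + 1)) => g (bpos b)) (w := fun _ : Bond d (towerP L m (n + 1)) => c₀))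
    (fun x => ⟨_, gaugeW_apply_inv φ _ x⟩) (norm_gaugeW φ (w := fun _ : Bond d (towerP L m (n + 1)) => c₀) _ fun b => hAd (bpos b)) (norm_gaugeW φ (w := fun _ : Bond d (towerP L m (n + 1)) => c₀) _ fun b => hAd (bpos b))
    (G1k_gaugeU L m n hL hL2 hS U hU g hg hα hα3 hα2 h52 φ τ η αU hα1 hU1 hreg hU1' hreg' hτ hstar hAd hpos hpos') hC y

include hL2 hS hU hg hα hα3 hα2 h52 hτ hstar hAd in
/-- **`‖H_{1,k}(U^u)Q_k(U^u)G_k(U^u)y‖ ≤ C‖y‖` from the same bound at `U`** (the first conjunct of the owner's (B3), carried). [cite: Balaban1985BackgroundPropagators, (3.34) p.396, (3.126) p.420, (3.153) p.426] -/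
theorem norm_H1kQkG1k_gaugeU_of_bound (hQs : Function.Surjective (QkW L m n φ U hL αU hα1 hU1 hreg (c₀ := c₀) (c₁ := c₁)))
    (hQs' : Function.Surjective (QkW L m n φ (gaugeU g U) hL αU hα1 hU1' hreg' (c₀ := c₀) (c₁ := c₁))) {C : ℝ}
    (hC : ∀ y : BondL2K ℂ d (towerP L m (n + 1)) c₀ W,
      ‖H1LatticeK hpos hQs (QkW L m n φ U hL αU hα1 hU1 hreg (c₁ := c₁) (G1LatticeK hpos y))‖ ≤ C * ‖y‖)
    (y : BondL2K ℂ d (towerP L m (n + 1)) c₀ W) :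
    ‖H1LatticeK hpos' hQs' (QkW L m n φ (gaugeU g U) hL αU hα1 hU1' hreg' (c₁ := c₁) (G1LatticeK hpos' y))‖ ≤ C * ‖y‖ := by
  refine norm_le_of_intertwine (fun y => H1LatticeK hpos hQs (QkW L m n φ U hL αU hα1 hU1 hreg (c₁ := c₁) (G1LatticeK hpos y)))
    (fun y => H1LatticeK hpos' hQs' (QkW L m n φ (gaugeU g U) hL αU hα1 hU1' hreg' (c₁ := c₁) (G1LatticeK hpos' y)))
    (gaugeW φ (fun b : Bond d (towerP L m (n + 1)) => g (bpos b)) (w := fun _ : Bond d (towerP L m (n + 1)) => c₀))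
    (gaugeW φ (fun b : Bond d (towerP L m (n + 1)) => g (bpos b)) (w := fun _ : Bond d (towerP L m (n + 1)) => c₀))
    (fun x => ⟨_, gaugeW_apply_inv φ _ x⟩) (norm_gaugeW φ (w := fun _ : Bond d (towerP L m (n + 1)) => c₀) _ fun b => hAd (bpos b)) (norm_gaugeW φ (w := fun _ : Bond d (towerP L m (n + 1)) => c₀) _ fun b => hAd (bpos b)) (fun y => ?_) hC y
  show H1LatticeK hpos' hQs' (QkW L m n φ (gaugeU g U) hL αU hα1 hU1' hreg' (c₁ := c₁)
      (G1LatticeK hpos' (gaugeW φ (fun b : Bond d (towerP L m (n + 1)) => g (bpos b)) y))) = _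
  rw [G1k_gaugeU L m n hL hL2 hS U hU g hg hα hα3 hα2 h52 φ τ η αU hα1 hU1 hreg hU1' hreg' hτ hstar hAd hpos hpos',
    QkW_gaugeU L m n hL hL2 hS U hU g hg hα hα3 hα2 h52 φ αU hα1 hU1 hreg hU1' hreg',
    H1k_gaugeU L m n hL hL2 hS U hU g hg hα hα3 hα2 h52 φ τ η αU hα1 hU1 hreg hU1' hreg' hτ hstar hAd hpos hpos' hQs hQs']

include hL2 hS hU hg hα hα3 hα2 h52 hτ hstar hAd in
/-- **`‖𝔊_k(U^u)x‖ ≤ C‖x‖` from `‖𝔊_k(U)x‖ ≤ C‖x‖`** (the first conjunct of the owner's (B4) — [B9] Thm 3.13's `L²` clause — carried). [cite: Balaban1985BackgroundPropagators, (3.34) p.396, (3.153) p.426, Thm 3.13 p.427] -/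
theorem norm_frakGk_gaugeU_of_bound (hQs : Function.Surjective (QkW L m n φ U hL αU hα1 hU1 hreg (c₀ := c₀) (c₁ := c₁)))
    (hQs' : Function.Surjective (QkW L m n φ (gaugeU g U) hL αU hα1 hU1' hreg' (c₀ := c₀) (c₁ := c₁))) {C : ℝ}
    (hC : ∀ x : BondL2K ℂ d (towerP L m (n + 1)) c₀ W, ‖frakGLatticeK hpos hQs x‖ ≤ C * ‖x‖) (x : BondL2K ℂ d (towerP L m (n + 1)) c₀ W) :
    ‖frakGLatticeK hpos' hQs' x‖ ≤ C * ‖x‖ :=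
  norm_le_of_intertwine _ _ (gaugeW φ (fun b : Bond d (towerP L m (n + 1)) => g (bpos b)) (w := fun _ : Bond d (towerP L m (n + 1)) => c₀))
    (gaugeW φ (fun b : Bond d (towerP L m (n + 1)) => g (bpos b)) (w := fun _ : Bond d (towerP L m (n + 1)) => c₀))
    (fun x => ⟨_, gaugeW_apply_inv φ _ x⟩) (norm_gaugeW φ (w := fun _ : Bond d (towerP L m (n + 1)) => c₀) _ fun b => hAd (bpos b)) (norm_gaugeW φ (w := fun _ : Bond d (towerP L m (n + 1)) => c₀) _ fun b => hAd (bpos b))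
    (frakGk_gaugeU L m n hL hL2 hS U hU g hg hα hα3 hα2 h52 φ τ η αU hα1 hU1 hreg hU1' hreg' hτ hstar hAd hpos hpos' hQs hQs') hC x

end Literature.MathematicalPhysics.QuantumFieldTheory.Balaban1983to89.B9Eq334GreenkCovariance

end
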